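import Summits.BirchSwinnertonDyer.BirchSwinnertonDyer.Theorems.AdditiveBranchIMCMultLowerFieldSupplyMClass
import Summits.BirchSwinnertonDyer.Rank1Residual.X11b.CastellaErratumTwist
import Literature.NumberTheory.EllipticCurves.QuadraticTwistPadicReduction
import Literature.NumberTheory.EllipticCurves.BSDSelmerSkinnerThmBProofs
import Literature.NumberTheory.EllipticCurves.PAdicBSDSplitMultiplicativeProofs
import Literature.NumberTheory.EllipticCurves.LFunctionPrimeCoeff
import HarnessLib

/-!
# Route `AdditiveBranchIMC` (rung K1), crux `MultLower` (stmt-BirchSwinnertonDyer-19359), line `tame_roads_mult`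
# v4, stub `stub_fieldSupplyM`: FIELD 2, step 3 — local analysis of the partner `A` on the (M) cell

Cell `bsd-addord`, seat `bsd-line-addord-w2`. THEOREMS ONLY; no definition, no named fact, no `sorry`.

The (M) twin of `exists_fieldTwo_gordTwo` (`…GordTwoRankZeroOffCaseOneFieldSupplyR0Local`): FIELD 2 of
`stub_fieldSupplyM` assembled from the auxiliary twist (`exists_auxTwist_mult`, sign by the (M) sign law) and
the ramified class (`exists_ramifiedClass_partner_mult`). The partner `A ≅ Wd^{(d'')} ≅ E^{(u)}`,
`u = p*δ₁ℓ₀*d`, is MULTIPLICATIVE NON-SPLIT at `p`; at every bad prime `ℓ ≠ p` of `E` the parameter `u` is an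
`ℓ`-adic square, so `A ⊗ ℚ_ℓ ≅ E ⊗ ℚ_ℓ` (same reduction type, same `v_ℓ(Δ_min)`, same `c_ℓ`); elsewhere `A` is
not split multiplicative, so `c_v(A) ≤ 4 < p` (Kodaira–Néron). Hence `p ∤ ∏ c(A)`, and the clauses of
`RamifiedKolyvaginFieldM Wd A p K''` hold — including the one AT `p` (`A` multiplicative, non-split).

References: [FriedbergHoffstein1995] Thm. B; [JetchevSkinnerWan2017] §7.4.1; [SilvermanAEC2009] VII.5–6, X.5.4;
[Castella2018] erratum (local Tamagawa numbers under unit twists).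
-/

set_option linter.dupNamespace false

noncomputable section

open scoped Classical

open WeierstrassCurve NumberField IsDedekindDomain
  Literature.NumberTheory.EllipticCurves
  Literature.NumberTheory.EllipticCurves.ModularForms
  Literature.NumberTheory.EllipticCurves.Rank1Residual
  Literature.NumberTheory.QuadraticFields
  Summit.BirchSwinnertonDyer.Rank1Residual
  Summit.BirchSwinnertonDyer.Rank1Residual.Additive

namespace Summit.BirchSwinnertonDyer.BirchSwinnertonDyer.Theorems.ThreeFieldRoadSupply

open NumberTheorySymbols Rat.HeightOneSpectrum Literature.NumberTheory.EllipticCurves.Castella2018.TamagawaQuadratic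

/-! ### FIELD 2 assembled on the (M) cell -/

section FieldTwoM

variable (W : WeierstrassCurve ℚ) [W.IsElliptic] [W.IsGloballyMinimal] (p : ℕ) [hp : Fact p.Prime]
  {q : ℕ} [hq : Fact q.Prime] (K : Type) [Field K] [NumberField K]
  {Wd : WeierstrassCurve ℚ} [Wd.IsElliptic] [Wd.IsGloballyMinimal]

omit [Wd.IsGloballyMinimal] in
/-- **FIELD 2 of `stub_fieldSupplyM` (line `tame_roads_mult` v4, crux 19359), from Friedberg–Hoffstein
Thm. B with prescribed splitting and the (M) sign law.** For `(E, p)` additive at `p ≥ 5` with multiplicative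
twist model `C' • V^{(p*)} = W`, `w(E) = +1`, `ρ̄_{E,p}` onto, `p ∤ ∏ c(E)`, a Wan prime `q` (`q ∉ {2, p}`,
non-split multiplicative, `p ∤ v_q(Δ)`), the tame-road field `K` and a globally minimal `Wd ≅ E^{(d_K)}`: a
`p`-RAMIFIED Kolyvagin field `K''` for `(Wd, A)` (`RamifiedKolyvaginFieldM Wd A p K''` spelled out, the clause at
`p` included) with a free ramified prime, and a globally minimal `A ≅ Wd^{(d_{K''})}` of analytic rank `0`,
MULTIPLICATIVE NON-SPLIT at `p`, `ρ̄_{A,p}` onto, multiplicative at `q` with `p ∤ v_q(Δ_A)`, and `p ∤ ∏ c(A)`.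
[cite: FriedbergHoffstein1995, Thm. B (1), as applied in JetchevSkinnerWan2017 §7.4.1]
[cite: SilvermanAEC2009, X.5 Cor. 5.4, VII.5.1 and Thm VII.6.1] -/
theorem exists_fieldTwo_mult
    (hFH : friedbergHoffstein_exists_heegnerField_splitDivisors_twist_ne_zero)
    (hmod : exists_isNewformOf) (hL : hasEntireLFunction_rat)
    (hp5 : 5 ≤ p) (hw : W.rootNumber = 1) (hadd : Addv W p) (hsurj : Surj W p)
    (htam : ¬ p ∣ W.tamagawaProduct)
    (hqp : q ≠ p) (hq2 : q ≠ 2) (hqm : W.HasMultiplicativeReductionAtPrime q)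
    (hqns : ¬ W.HasSplitMultiplicativeReductionAtPrime q)
    (hqv : ¬ p ∣ padicValInt q W.minimalDiscriminantInt)
    (hK : IsImaginaryQuadratic K) (h2K : ((Ideal.span {(2 : ℤ)}).primesOver (𝓞 K)).ncard = 2)
    (hqd : (q : ℤ) ∣ NumberField.discr K)
    (hsplit : ∀ ℓ : ℕ, ℓ.Prime → ℓ ∣ W.conductorNorm ℤ → ℓ ≠ q →
      ((Ideal.span {(ℓ : ℤ)}).primesOver (𝓞 K)).ncard = 2)
    (Cd : VariableChange ℚ) (hWd : Cd • W.quadraticTwist (NumberField.discr K : ℚ) = Wd)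
    (V : WeierstrassCurve ℚ) [V.IsElliptic] [V.IsGloballyMinimal] (C' : VariableChange ℚ)
    (hC' : C' • V.quadraticTwist ((-1 : ℚ) ^ (p / 2) * p) = W)
    (hmultV : V.HasMultiplicativeReductionAtPrime p) :
    ∃ (K'' : Type) (_ : Field K'') (_ : NumberField K'')
      (A : WeierstrassCurve ℚ) (_ : A.IsElliptic) (_ : A.IsGloballyMinimal),
      (IsImaginaryQuadratic K'' ∧ (p : ℤ) ∣ NumberField.discr K'' ∧
        (∀ ℓ : ℕ, ℓ.Prime → ℓ ∣ Wd.conductorNorm ℤ → ¬ (ℓ : ℤ) ∣ NumberField.discr K'' →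
          SatisfiesHeegnerHypothesis ℓ K'') ∧
        (∀ ℓ : ℕ, (hℓ : ℓ.Prime) → ℓ ∣ Wd.conductorNorm ℤ → (ℓ : ℤ) ∣ NumberField.discr K'' →
          (haveI : Fact ℓ.Prime := ⟨hℓ⟩;
            A.HasMultiplicativeReductionAtPrime ℓ ∧ ¬ A.HasSplitMultiplicativeReductionAtPrime ℓ)) ∧
        ¬ A.HasSplitMultiplicativeReductionAtPrime p) ∧
      (∃ ℓ : ℕ, ℓ.Prime ∧ (ℓ : ℤ) ∣ NumberField.discr K'' ∧ ℓ ≠ p ∧ ¬ ℓ ∣ Wd.conductorNorm ℤ) ∧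
      (∃ C : VariableChange ℚ, C • Wd.quadraticTwist (NumberField.discr K'' : ℚ) = A) ∧
      A.analyticRank = 0 ∧ A.HasMultiplicativeReductionAtPrime p ∧ Surj A p ∧
      (∃ ℓ : ℕ, ∃ _ : Fact ℓ.Prime, ℓ ≠ p ∧ A.HasMultiplicativeReductionAtPrime ℓ ∧
        ¬ p ∣ padicValInt ℓ A.minimalDiscriminantInt) ∧
      ¬ p ∣ A.tamagawaProduct := by
  have hp2 : p ≠ 2 := by omega
  have hNWd0 : Wd.conductorNorm ℤ ≠ 0 := (Wd.conductorNorm_pos_holds).ne'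
  obtain ⟨δ, ℓ₀, X, iX, iXm, CX, hfac, hδsq, hpδ, hℓ₀, hℓ₀p, hℓ₀q, hℓ₀M, hℓ₀δ, h8ℓ₀, hJsplit, hJq, hJp, hT4,
      hneg, hb, h8, hCX, hXroot⟩ :=
    exists_auxTwist_mult W p K V hmod hp5 hw hadd hqp hq2 hqm hK h2K hqd hsplit C' hC' hmultV
      (Wd.conductorNorm ℤ) hNWd0
  obtain ⟨T, d, K'', iF'', iN'', A, iA, iAm, hT, hdisc, hK'', hsplit'', hram'', hAWd, ⟨Cu, hCu⟩, hu4, husq,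
      hJu, hrA, ⟨hmA, hnsA⟩, hsurjA⟩ :=
    exists_ramifiedClass_partner_mult W p K hFH hL hp5 hsurj hqp hq2 hK h2K Cd hWd V C' hC'
      hmultV hfac hδsq hpδ hℓ₀ hℓ₀p hℓ₀q hℓ₀M hℓ₀δ h8ℓ₀ hJsplit hJq hJp hT4 hneg hb h8 CX hCX hXroot
  have hℓ₀NWd : ¬ ℓ₀ ∣ Wd.conductorNorm ℤ := fun h ↦ hℓ₀M (h.mul_left _)
  set u : ℤ := ((-1 : ℤ) ^ (p / 2) * p) * T * d with hu
  -- `u ≠ 0, 1`, `p ∣ u`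
  have hpu : (p : ℤ) ∣ u := by
    rw [hu]
    refine Dvd.dvd.mul_right (Dvd.dvd.mul_right ?_ _) _
    exact Dvd.intro_left _ rfl
  have hu1 : u ≠ 1 := fun h ↦ by
    rw [h] at hpu
    exact hp.out.ne_one (by exact_mod_cast Int.eq_one_of_dvd_one (by norm_num) hpu)
  have hu0 : u ≠ 0 := fun h ↦ by rw [h] at hu4; norm_num at hu4
  have huq : ((u : ℤ) : ℚ) ≠ 0 := by exact_mod_cast hu0
  -- squares at the bad primes `≠ p` of `E`
  have hsq : ∀ ℓ : ℕ, (hℓ : ℓ.Prime) → ℓ ∣ W.conductorNorm ℤ → ℓ ≠ p →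
      (haveI : Fact ℓ.Prime := ⟨hℓ⟩; IsSquare (((u : ℤ) : ℚ) : ℚ_[ℓ])) := by
    intro ℓ hℓ hℓN hℓp
    haveI : Fact ℓ.Prime := ⟨hℓ⟩
    exact isSquare_padic_of_fundamental hu4 husq hu1 (hJu ℓ hℓ hℓN hℓp)
  -- at the Wan prime `q`
  have hqN : q ∣ W.conductorNorm ℤ :=
    (W.dvd_conductorNorm_iff_not_hasGoodReductionAtPrime q).mpr
      (not_hasGoodReductionAtPrime_of_hasMultiplicativeReductionAtPrime q hqm)
  have hsqq : IsSquare (((u : ℤ) : ℚ) : ℚ_[q]) := hsq q hq.out hqN hqp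
  have hmultAq : A.HasMultiplicativeReductionAtPrime q :=
    (X11b.mult_iff_of_twist W huq hsqq A hCu).mpr hqm
  have hnsAq : ¬ A.HasSplitMultiplicativeReductionAtPrime q := by
    haveI := W.isElliptic_quadraticTwist huq
    rw [← hCu, hasSplitMultiplicativeReductionAtPrime_smul_iff,
      hasSplitMultiplicativeReductionAtPrime_quadraticTwist_iff W huq (by simpa using hsqq)]
    exact hqns
  have hΔq : padicValInt q A.minimalDiscriminantInt = padicValInt q W.minimalDiscriminantInt :=
    X11b.padicValInt_minimalDiscriminantInt_twist_eq W q huq (by simpa using hsqq) Cu hCu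
  -- the Tamagawa product of `A`
  have hjA : A.j = W.j := AdditivePotMult.j_of_model_twist huq ⟨Cu, hCu⟩
  have htamA : ¬ p ∣ A.tamagawaProduct := by
    refine not_dvd_tamagawaProduct_of_forall A p fun v ↦ ?_
    set ℓ : ℕ := (primesEquiv v : ℕ) with hℓdef
    haveI hℓF : Fact ℓ.Prime := ⟨(primesEquiv v).2⟩
    by_cases hcase : ℓ ∣ W.conductorNorm ℤ ∧ ℓ ≠ p
    · -- `A ⊗ ℚ_ℓ ≅ E ⊗ ℚ_ℓ`: same local Tamagawa number, and `p ∤ c_ℓ(E)`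
      rw [localTamagawaNumber_eq_of_twist_of_isSquare W v (ℓ := ℓ) rfl huq
        (hsq ℓ hℓF.out hcase.1 hcase.2) A hCu]
      intro hdvd
      apply htam
      set cW : HeightOneSpectrum (𝓞 ℚ) → ℕ := fun v =>
        (W.baseChange (v.adicCompletion ℚ)).localTamagawaNumber (v.adicCompletionIntegers ℚ) with hcW
      have hfin : (Function.mulSupport cW).Finite := W.mulSupport_localTamagawaNumber_finite_holds
      rw [show W.tamagawaProduct = ∏ᶠ v, cW v from rfl,
        finprod_eq_prod_of_mulSupport_subset cW (s := hfin.toFinset) (by simp)]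
      by_cases hv1 : cW v = 1
      · exfalso
        have : p ∣ 1 := by rw [← hv1]; exact hdvd
        exact hp.out.ne_one (Nat.dvd_one.mp this)
      · exact hdvd.trans (Finset.dvd_prod_of_mem cW (hfin.mem_toFinset.mpr hv1))
    · -- `A` is not split multiplicative at `v`: `c_v(A) ≤ 4 < p`
      obtain ⟨h1, -, h4⟩ := kodairaNeron_localTamagawaNumber A v
      have hns : ¬ A.HasSplitMultiplicativeReductionAt v := by
        intro hsplitv
        by_cases hℓp : ℓ = p
        · -- `A` is multiplicative NON-SPLIT at `p`
          have h1 := (A.hasSplitMultiplicativeReductionAtPrime_iff_hasSplitMultiplicativeReductionAt v).mpr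
            hsplitv
          have key : ∀ (n : ℕ) (i₁ : Fact n.Prime) (i₂ : Fact p.Prime), n = p →
              @HasSplitMultiplicativeReductionAtPrime A n i₁ →
                @HasSplitMultiplicativeReductionAtPrime A p i₂ := by
            rintro n i₁ i₂ rfl h; exact h
          exact hnsA (key _ _ _ hℓp h1)
        · have hmult := hsplitv.hasMultiplicativeReductionAt
          have hlt := one_lt_valuation_j v A hmult
          have hle : v.valuation ℚ A.j ≤ 1 := by
            -- `E` is good at `ℓ ∤ N_E`, and `j(A) = j(E)`
            have hℓN : ¬ ℓ ∣ W.conductorNorm ℤ := fun h ↦ hcase ⟨h, hℓp⟩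
            have hgood : W.HasGoodReductionAtPrime ℓ :=
              not_not.mp (mt (W.dvd_conductorNorm_iff_not_hasGoodReductionAtPrime ℓ).mpr hℓN)
            rw [hjA]
            exact Additive.valuation_j_le_one_of_hasGoodReductionAt W v
              ((hasGoodReductionAtPrime_iff_hasGoodReductionAt_ringOfIntegers v W).mp hgood)
          exact (not_lt.mpr hle) hlt
      have hc4 := h4 hns
      intro hdvd
      have := Nat.le_of_dvd (by omega) hdvd
      omega
  refine ⟨K'', iF'', iN'', A, iA, iAm, ⟨hK'', ?_, ?_, ?_, hnsA⟩, ⟨ℓ₀, hℓ₀, ?_, hℓ₀p, hℓ₀NWd⟩, hAWd, hrA,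
    hmA, hsurjA, ⟨q, hq, hqp, hmultAq, by rw [hΔq]; exact hqv⟩, htamA⟩
  · -- `p ∣ d_{K''}`
    rw [hdisc]
    exact Dvd.dvd.mul_right (Dvd.dvd.mul_right (Dvd.dvd.mul_right (Dvd.intro_left _ rfl) _) _) _
  · -- every prime of `N_{Wd}` off `d_{K''}` splits in `K''`
    intro ℓ hℓ hℓN hℓD
    have hℓp : ℓ ≠ p := by
      rintro rfl
      apply hℓD
      rw [hdisc]
      exact Dvd.dvd.mul_right (Dvd.dvd.mul_right (Dvd.dvd.mul_right (Dvd.intro_left _ rfl) _) _) _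
    have hℓq : ℓ ≠ q := by
      rintro rfl
      apply hℓD
      rw [hdisc]
      exact Dvd.dvd.mul_right (Dvd.dvd.mul_right (Dvd.dvd.mul_left (Dvd.intro_left _ rfl) _) _) _
    exact hsplit'' ℓ hℓ (hℓN.mul_left _) hℓp hℓq
  · -- the common primes of `N_{Wd}` and `d_{K''}`: `p` (multiplicative non-split) and `q` (non-split)
    intro ℓ hℓ hℓN hℓD
    rcases hram'' ℓ hℓ hℓD (hℓN.mul_left _) with h | h
    · subst h
      have key : ∀ (i₁ i₂ : Fact ℓ.Prime),
          (@HasMultiplicativeReductionAtPrime A ℓ i₂ ∧ ¬ @HasSplitMultiplicativeReductionAtPrime A ℓ i₂) →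
            (@HasMultiplicativeReductionAtPrime A ℓ i₁ ∧ ¬ @HasSplitMultiplicativeReductionAtPrime A ℓ i₁) := by
        intro i₁ i₂ h; exact h
      exact key _ _ ⟨hmA, hnsA⟩
    · subst h
      exact ⟨hmultAq, hnsAq⟩
  · -- the free prime `ℓ₀ ∣ d_{K''}`
    rw [hdisc]
    exact Dvd.dvd.mul_right (Dvd.dvd.mul_left (Dvd.intro_left _ rfl) _) _

end FieldTwoM

end Summit.BirchSwinnertonDyer.BirchSwinnertonDyer.Theorems.ThreeFieldRoadSupply

end
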